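import Mathlib
import Summits.KontsevichZagierPeriods.Zeta5Search.BrickTheoremTen

/-!
# BrickClassDenominators — the Krattenthaler–Rivoal exponent holds RESIDUE CLASS BY RESIDUE CLASS mod `p`:
`ord_p Σ_{k ≤ n, k ≡ a ∨ k ≡ n−a (mod p)} c_{k,s}(n) ≥ −⌊log_p n⌋·(A−1−s)` for the very-well-poised brick kernels, every odd
prime `p` (cell zeta5-irr)

HONEST FRAMING: systematic search; no irrationality claim unless certified. INSTRUMENT-tier arithmetic of the ζ(5)
census cell zeta5-irr (HOME `run/shared/lean/pub/zeta5-irr/`), filed by the engine seat zi-eng (g12); sequel of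
`BrickDenominators` (the exponent for the full sums `x_s(n) = Σ_k c_{k,s}(n)`, = Krattenthaler–Rivoal 2007 Théorème 1 at
odd primes). WHAT THIS IS NOT: no denominator saving for the linear forms beyond Krattenthaler–Rivoal's (the full-sum
exponent is unchanged); nothing at `p = 2`; nothing about ζ(5); 0 nats/n; rung F-Z1 NOT moved.

## The statement (`p` odd prime, `A` even, `1 ≤ B`, `2B ≤ A`; kernel `R_n^{(A,B,1)}`, cells `c_{k,s}(n) = BrickLaurent.cell`)

zi-p2's PROPOSITION H^∞ (`BrickPropositionHInf.level_step_inf`) holds for EVERY `p`-integral, symmetric, digit-local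
weight. The indicator `g` of a symmetric pair of residue classes `{k ≡ a} ∪ {k ≡ n − a} (mod p)` (written inline as an `if`) is such a
weight: it is a function of `k mod p` (so (D) holds at every depth `e ≥ 1`, `natCast_zmod_eq_of_pow_dvd_sub`) and
`g(n−k) = g(k)` (`classPair_reflect`). Hence (`level_class`) for every `L`, `n < p^{L+1}`, `a`:
`v(Σ_{k ≤ n, k ≡ ±a} p^{L(A−s)}c_{k,s}(n)) ≤ exp(−L)` and the same for the harmonic cells `cell^{(0)}_k(n)`; i.e.
(`padicValuation_classSum_le`, `padicValuation_classSum_zero_le`)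

  **`ord_p Σ_{k ≤ n, k ≡ a ∨ k ≡ n−a (p)} c_{k,s}(n) ≥ −⌊log_p n⌋·(A−1−s)`**,  **`ord_p Σ_{k ≡ ±a} cell^{(0)}_k(n) ≥ −⌊log_p n⌋·(A−1)`**.

Summing over the `(p+1)/2` class pairs gives back `BrickDenominators.padicValuation_xCoeff_le`; for odd `s` the cells are
symmetric (`c_{n−k,s} = c_{k,s}`, `BrickLinearForms.kerNum_reflect`), so each SINGLE class `k ≡ a` carries the bound too
(`p` odd). Not found in print: Krattenthaler–Rivoal's proof (Mem. AMS 875, 2007, §5: Andrews's multisum identity) bounds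
the full sum, Zudilin's Lemmas 17–18 (JTNB 16, 2004, §7) single cells; neither speaks of partial sums over residue
classes. Exact pre-typing check (this seat, local, exact arithmetic): 0 failures among 13 440 full/class-pair instances
`(A,B) ∈ {(4,1),(6,1),(6,2),(8,1),(8,2),(8,3)}`, `n ≤ 12`, `p ∈ {3,5,7,11}`; single unpaired classes, odd `s`: 0 of 624;
termwise the exponent fails in 296 of 1 932 cells (`p ∈ {3,5}`), so the class sums do cancel.
-/

namespace Summit.KontsevichZagierPeriods.Zeta5Search.BrickClassDenominators

open Finset Nat WithZero
open Summit.KontsevichZagierPeriods.Zeta5Search.BrickLaurent (cell)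
open Summit.KontsevichZagierPeriods.Zeta5Search.BrickPartialFractions (cellZero xCoeff xZero)
open Summit.KontsevichZagierPeriods.Zeta5Search.BrickTopKummer (cell_one_valuation_abs)
open Summit.KontsevichZagierPeriods.Zeta5Search.BrickHoleCells (pow_mul_cellZero_valuation)
open Summit.KontsevichZagierPeriods.Zeta5Search.BrickPropositionHInf (level_step_inf propositionH_inf)

noncomputable section

variable {p : ℕ} [Fact p.Prime]

/-! ## PROPOSITION H^∞ with a residue-class weight: the saving holds class by class mod `p` -/

/-- Symmetry of the class-pair indicator: membership of `n − k` in `{≡ a} ∪ {≡ n − a}` is membership of `k`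
(`k ≤ n`). -/
theorem classPair_reflect {n k : ℕ} (hk : k ≤ n) (a : ZMod p) :
    (((n - k : ℕ) : ZMod p) = a ∨ ((n - k : ℕ) : ZMod p) = (n : ZMod p) - a) ↔
      ((k : ZMod p) = a ∨ (k : ZMod p) = (n : ZMod p) - a) := by
  rw [Nat.cast_sub hk]
  have h1 : ((n : ZMod p) - k = a) ↔ ((k : ZMod p) = n - a) := by
    constructor
    · intro h; rw [← h]; ring
    · intro h; rw [h]; ring
  have h2 : ((n : ZMod p) - k = n - a) ↔ ((k : ZMod p) = a) := by
    constructor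
    · intro h; exact sub_right_injective h
    · intro h; rw [h]
  rw [h1, h2, or_comm]

/-- Locality of the class-pair indicator: `p^e ∣ k − k'` with `e ≥ 1` forces `k ≡ k' (mod p)`. -/
theorem natCast_zmod_eq_of_pow_dvd_sub {k k' e : ℕ} (he : 1 ≤ e) (hdvd : (p : ℤ) ^ e ∣ (k : ℤ) - k') :
    (k : ZMod p) = (k' : ZMod p) := by
  have hp : (p : ℤ) ∣ (k : ℤ) - k' := (dvd_pow_self (p : ℤ) (by omega)).trans hdvd
  have h := (ZMod.intCast_eq_intCast_iff_dvd_sub (k' : ℤ) (k : ℤ) p).2 hp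
  simpa using h.symm

section classes

variable (hp2 : p ≠ 2) {A B : ℕ} (hA : Even A) (hB : 1 ≤ B) (hAB : 2 * B ≤ A)
include hp2 hA hB hAB

/-- **H^∞, residue-class weight** (every odd prime `p`; EVERY level `L`, row `n < p^{L+1}`, kernel `ε = 1`; every residue
`a mod p`): the PARTIAL sums of the level-`L` residues over the symmetric class pair `k ≡ a ∨ k ≡ n − a (mod p)` already
satisfy `v(Σ_{k in the pair} p^{L(A−s)}c_{k,s}(n)) ≤ exp(−L)` (and the harmonic cells likewise) — i.e. the saving of one
`⌊log_p n⌋` over the termwise bound holds CLASS BY CLASS, not only for the full sum `x_s(n)`. -/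
theorem level_class {L n : ℕ} (hn : n < p ^ (L + 1)) (a : ZMod p) :
    Rat.padicValuation p (∑ j ∈ (range (n + 1)).filter (fun j : ℕ => (j : ZMod p) = a ∨ (j : ZMod p) = (n : ZMod p) - a),
        (p : ℚ) ^ (L * A) * cellZero A B 1 n j) ≤ exp (-(L : ℤ)) ∧
      ∀ s, Rat.padicValuation p
        (∑ j ∈ (range (n + 1)).filter (fun j : ℕ => (j : ZMod p) = a ∨ (j : ZMod p) = (n : ZMod p) - a),
          (p : ℚ) ^ (L * (A - s)) * cell A B 1 n j s) ≤ exp (-(L : ℤ)) := by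
  have hp : p.Prime := Fact.out
  rcases L with _ | L
  · refine ⟨?_, fun s => ?_⟩
    · rw [Nat.cast_zero, neg_zero, exp_zero, zero_mul]
      refine Valuation.map_sum_le _ fun j hj => ?_
      have hj' : j ≤ n := by have := mem_range.1 (mem_filter.1 hj).1; omega
      refine (pow_mul_cellZero_valuation hp2 hAB (L := 0) hn hj' 0).trans (exp_le_exp.2 ?_)
      simp only [Nat.cast_zero, zero_mul, Nat.cast_mul]
      nlinarith [Int.natCast_nonneg A, Int.natCast_nonneg (padicValNat p (n.choose j))]
    · rw [Nat.cast_zero, neg_zero, exp_zero, zero_mul, pow_zero]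
      refine Valuation.map_sum_le _ fun j hj => ?_
      have hj' : j ≤ n := by have := mem_range.1 (mem_filter.1 hj).1; omega
      have h := cell_one_valuation_abs hp2 hAB (L := 0) hn hj' s
      rw [Nat.cast_zero, zero_mul, exp_zero] at h
      rwa [one_mul]
  · obtain ⟨n₀, N, hn₀, rfl⟩ : ∃ n₀ N, n₀ < p ∧ n = n₀ + N * p :=
      ⟨n % p, n / p, Nat.mod_lt _ hp.pos, (Nat.mod_add_div' n p).symm⟩
    have hN : N < p ^ (L + 1) := by
      rw [Nat.lt_iff_add_one_le]
      by_contra h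
      have h' : p ^ (L + 1) ≤ N := by omega
      have : p ^ (L + 1 + 1) ≤ n₀ + N * p := by
        calc p ^ (L + 1 + 1) = p ^ (L + 1) * p := pow_succ _ _
          _ ≤ N * p := Nat.mul_le_mul_right _ h'
          _ ≤ n₀ + N * p := Nat.le_add_left _ _
      omega
    -- the weight: indicator of the class pair `{k ≡ a} ∪ {k ≡ n − a} (mod p)`
    have hgI : ∀ k, k ≤ n₀ + N * p → Rat.padicValuation p
        ((fun k : ℕ => if (k : ZMod p) = a ∨ (k : ZMod p) = ((n₀ + N * p : ℕ) : ZMod p) - a then (1 : ℚ) else 0) k) ≤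
          1 := fun k _ => by
      simp only
      split_ifs
      · exact (map_one _).le
      · rw [map_zero]; exact _root_.zero_le
    have h := level_step_inf hp2 hA hB hAB (ε := 1) le_rfl hn₀ hN
      (g := fun k : ℕ => if (k : ZMod p) = a ∨ (k : ZMod p) = ((n₀ + N * p : ℕ) : ZMod p) - a then (1 : ℚ) else 0)
      hgI (fun k hk => ?_) (fun e k k' he _ _ _ hdvd => ?_)
      (fun M' hM' g' h1 h2 h3 => propositionH_inf hp2 hA hB hAB L M' hM' g' h1 h2 h3)
    · simp only [ite_mul, one_mul, zero_mul, ← Finset.sum_filter] at h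
      exact_mod_cast h
    · simp only [classPair_reflect hk, pow_one, neg_one_mul, ← sub_eq_add_neg, sub_self, map_zero]
      exact _root_.zero_le
    · simp only [natCast_zmod_eq_of_pow_dvd_sub he hdvd, sub_self, map_zero]
      exact _root_.zero_le

/-- **The Krattenthaler–Rivoal exponent class by class** (odd `p`, every `n`, `s`, residue `a`):
`v(Σ_{k ≤ n, k ≡ a ∨ k ≡ n−a (p)} c_{k,s}(n)) ≤ exp(⌊log_p n⌋·(A−1−s))`. For odd `s` the cells are symmetric
(`c_{n−k,s} = c_{k,s}`), so each single class `k ≡ a` carries the bound as well; not found in print (the printed proofs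
bound the full sum `x_s(n)` via Andrews's identity, or each cell via Zudilin's Lemmas 17–18). -/
theorem padicValuation_classSum_le (n s : ℕ) (a : ZMod p) :
    Rat.padicValuation p (∑ j ∈ (range (n + 1)).filter (fun j : ℕ => (j : ZMod p) = a ∨ (j : ZMod p) = (n : ZMod p) - a),
        cell A B 1 n j s) ≤ exp ((Nat.log p n : ℤ) * ((A - 1 - s : ℕ) : ℤ)) := by
  have hp : p.Prime := Fact.out
  have hn : n < p ^ (Nat.log p n + 1) := Nat.lt_pow_succ_log_self hp.one_lt n
  have h := (level_class hp2 hA hB hAB hn a).2 s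
  rw [← Finset.mul_sum] at h
  rw [map_mul, map_pow, Rat.padicValuation_self, ← exp_nsmul, nsmul_eq_mul, mul_neg_one] at h
  have h' := mul_le_mul_right h (exp ((Nat.log p n * (A - s) : ℕ) : ℤ))
  rw [← mul_assoc, ← exp_add, add_neg_cancel, exp_zero, one_mul, ← exp_add] at h'
  refine h'.trans (exp_le_exp.2 ?_)
  have hτ : (A - s : ℕ) ≤ (A - 1 - s : ℕ) + 1 := by omega
  have hτ' : ((A - s : ℕ) : ℤ) ≤ ((A - 1 - s : ℕ) : ℤ) + 1 := by exact_mod_cast hτ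
  push_cast
  nlinarith [Int.natCast_nonneg (Nat.log p n), Int.natCast_nonneg (A - 1 - s)]

/-- The harmonic cells class by class: `v(Σ_{k ≡ a ∨ k ≡ n−a (p)} cell^{(0)}_k(n)) ≤ exp(⌊log_p n⌋·(A−1))`. -/
theorem padicValuation_classSum_zero_le (n : ℕ) (a : ZMod p) :
    Rat.padicValuation p (∑ j ∈ (range (n + 1)).filter (fun j : ℕ => (j : ZMod p) = a ∨ (j : ZMod p) = (n : ZMod p) - a),
        cellZero A B 1 n j) ≤ exp ((Nat.log p n : ℤ) * ((A - 1 : ℕ) : ℤ)) := by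
  have hp : p.Prime := Fact.out
  have hn : n < p ^ (Nat.log p n + 1) := Nat.lt_pow_succ_log_self hp.one_lt n
  have h := (level_class hp2 hA hB hAB hn a).1
  rw [← Finset.mul_sum] at h
  rw [map_mul, map_pow, Rat.padicValuation_self, ← exp_nsmul, nsmul_eq_mul, mul_neg_one] at h
  have h' := mul_le_mul_right h (exp ((Nat.log p n * A : ℕ) : ℤ))
  rw [← mul_assoc, ← exp_add, add_neg_cancel, exp_zero, one_mul, ← exp_add] at h'
  refine h'.trans (exp_le_exp.2 ?_)
  have hA1 : 1 ≤ A := by omega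
  push_cast [Nat.cast_sub hA1]
  nlinarith [Int.natCast_nonneg (Nat.log p n)]

end classes

end

end Summit.KontsevichZagierPeriods.Zeta5Search.BrickClassDenominators
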